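import Summits.AtomisticToContinuum.HydrodynamicLimit.Theses.TwoClocks
import Summits.AtomisticToContinuum.HydrodynamicLimit.Theorems.OneFlightGossipEngineUniformLocalGibbsConcentration
import Summits.AtomisticToContinuum.HydrodynamicLimit.Theorems.ImplosionDichotomyHsEosLowDensity
import Summits.AtomisticToContinuum.HydrodynamicLimit.Theorems.TwoClocksClampedWindowDockActivityInversion
import Summits.AtomisticToContinuum.HydrodynamicLimit.Theorems.ImplosionDichotomyDenseExcursionR2AdmissibleData
import HarnessLib

/-!
# Activity inversion for the kinetic-window entropy ledger, I: the thermodynamic activity inverts the density map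

Crux `Summit.AtomisticToContinuum.HydrodynamicLimit.Theses.AntiMazurCoboundaries.KineticWindowGronwall`
(stmt-AtomisticToContinuum-9282, `= KineticFluxLdDecay → RelEntropyVanishing`), line `dlr-block-transfer` v3, registered
stub `stub_pdeAndInversion : PdeAndInversion := TwoClocks.DiluteSelfConsistency ∧ ActivityInversion`. Its first conjunct
(3091) is an open problem; this file and its companion `…ActivityInversionDilute` settle the second, the entropy
ledger's MISSING HYPOTHESIS A (`ActivityInversion`, re-declared VERBATIM from the skeleton, `@[conjecture]`): with
`F := hsExcessFreeEnergy` and the THERMODYNAMIC ACTIVITY `α_σ(ρ) := ρ · exp(F(ρσ³) + ρσ³F′(ρσ³))`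
(`thermoActivity`), at small packing `ρσ³ ≤ η₁` the local Gibbs laws with activity `α_σ ∘ ρ` (i) have activity
ratio in `[1, 2]`, (ii) are probability measures, (iii) concentrate EXPONENTIALLY around the GIVEN
`(ρ, ρu, E(ρ,u,θ))`, (iv) are the only laws (activity mod constants) whose density field converges to `ρ`.

* `insertionFactor_package` — the bridge between the canonical free energy and the cluster expansion, assembled from
  landed theorems of route ImplosionDichotomy: the analytic insertion factor `Rf` of `stub_eosRatioAnalytic`
  (`Rf x · Φ(x Rf x) = 1`, `Φ(u) = Σ_j bE j uʲ/j!`, `1 ≤ Rf ≤ 2`, unique root) satisfies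
  `exp(F(η) + ηF′(η)) = Rf(η)` on `(0, η₂)` (`R2OneModeTwoConditions.excessChemicalPotential_eq_log`: the `limsup` and
  the `deriv` in `hsExcessFreeEnergy`, `hsCompressibility` are genuine there; the two insertion factors agree by
  uniqueness of the root). Hence `α_σ(ρ) = ρ · Rf(σ³ρ)` IS the inverted activity of
  `EntropyClockDock.activity_of_density` (13735 dock, II), whose cluster-series density `rhoLim` is EXACTLY `ρ`.
* `thermoActivity_spec` — (i) and the statics regime with the uniform smallness of 14445, at the universal threshold
  `thresh r η₂`; `σ < 1/2` is forced by `ρσ³ ≤ η₁ ≤ 1/16`, `∫ρ = 1` (so (ii) is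
  `isProbabilityMeasure_localGibbsLaw`).
* `thermoActivity_concentration` — (iii): the three field bounds of the PROVED 14445
  (`UniformLGC.localGibbsMeasure_density_le/…momentum_le/…energy_le`) at the activity `α_σ ∘ ρ`.
* Clause (iv) quantifies over ALL continuous positive activities `a'`, dilute or not; the tree's law of large numbers
  lives in the statics regime only, so (iv) as typed is the non-perturbative `ActivityUniquenessModConstants`
  (`@[conjecture]`, open). Registered helper stub `stub_activityInversionOfUniqueness :
  ActivityUniquenessModConstants → ActivityInversion` — hypothesis A is reduced to its clause (iv). The DILUTE form of
  (iv) (activity-ratio guard `σ³ sup a' ≤ η₁ ∫a'`, which the ledger's `t = 0` use supplies because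
  `RelEntropyVanishing` chooses `σ₀` after `a₀`) is a theorem: companion file,
  `stub_activityInversionDilute : ActivityInversionDilute`.

Sources: Ruelle 1969 §3.4 and Lebowitz–Penrose 1964 (low-density equation of state), Pulvirenti–Tsagkarogiannis 2012
(canonical cluster expansion), Spohn 1991 Part I §2.3 (local equilibrium), Kipnis–Landim 1999 App. 2 (LD upper bounds).
-/

noncomputable section

namespace Summit.AtomisticToContinuum.HydrodynamicLimit.Theorems.KineticWindowGronwallActivityInversion

open MeasureTheory Filter Set Topology
open scoped ENNReal
open Literature.MathematicalPhysics.KineticTheory Literature.Analysis.FluidPDE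
open Summit.AtomisticToContinuum.HydrodynamicLimit.Theorems.UniformLGC
open Summit.AtomisticToContinuum.HydrodynamicLimit.Theorems.EntropyClockDock
open Summit.AtomisticToContinuum.HydrodynamicLimit.Theorems.R2OneModeTwoConditions

/-! ### §1 The insertion factor is the exponential of the excess chemical potential -/

/-- **The insertion-factor package.** One function `Rf` (the analytic insertion factor of `stub_eosRatioAnalytic`)
with the functional equation `Rf x · Φ(x Rf x) = 1` (`Φ(u) = Σ_j bE j uʲ/j!`) and positivity on `(-r, r)`, the bounds
`1 ≤ Rf ≤ 2` and continuity on `[0, r]`, uniqueness of the root in `[1/2, 2]`, AND the thermodynamic identity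
`exp(f_ex(η) + η f_ex'(η)) = Rf(η)` on `(0, η₂)`, `f_ex = hsExcessFreeEnergy` (`excessChemicalPotential_eq_log`
states it for ITS insertion factor; the two agree on `(0, min η₁ r)` by uniqueness of the root). [folklore] -/
theorem insertionFactor_package :
    ∃ r : ℝ, 0 < r ∧ ∃ Rf : ℝ → ℝ,
      (∀ x ∈ Ioo (-r) r, 0 < Rf x ∧ Rf x * (∑' j : ℕ, bE j / (j.factorial : ℝ) * (x * Rf x) ^ j) = 1) ∧
      (∀ x ∈ Icc 0 r, 1 ≤ Rf x ∧ Rf x ≤ 2) ∧ ContinuousOn Rf (Icc 0 r) ∧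
      (∀ x ∈ Ioo (-r) r, ∀ R ∈ Icc (1 / 2 : ℝ) 2,
        R * (∑' j : ℕ, bE j / (j.factorial : ℝ) * (x * R) ^ j) = 1 → R = Rf x) ∧
      ∃ η₂ : ℝ, 0 < η₂ ∧ η₂ ≤ r ∧ ∀ η ∈ Ioo 0 η₂,
        Real.exp (hsExcessFreeEnergy η + η * deriv hsExcessFreeEnergy η) = Rf η := by
  obtain ⟨r, hr, Rf, -, -, -, hsol, hbd, hLip, huniq⟩ := stub_eosRatioAnalytic
  obtain ⟨η₁, hη₁, Rf₁, hlog, huniq₁⟩ := excessChemicalPotential_eq_log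
  have hcont : ContinuousOn Rf (Icc 0 r) := by
    obtain ⟨L, hL⟩ := hLip
    exact hL.continuousOn
  refine ⟨r, hr, Rf, hsol, hbd, hcont, huniq, min η₁ r, lt_min hη₁ hr, min_le_right _ _, fun η hη => ?_⟩
  have hη1 : η ∈ Ioo 0 η₁ := ⟨hη.1, hη.2.trans_le (min_le_left _ _)⟩
  have hηr : η < r := hη.2.trans_le (min_le_right _ _)
  have hηo : η ∈ Ioo (-r) r := ⟨by linarith [hη.1], hηr⟩
  have hηc : η ∈ Icc 0 r := ⟨hη.1.le, hηr.le⟩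
  have hroot : Rf η = Rf₁ η :=
    huniq₁ η hη1 (Rf η) ⟨by linarith [(hbd η hηc).1], (hbd η hηc).2⟩ (hsol η hηo).2
  have h := hlog η hη1
  rw [excessChemicalPotential] at h
  rw [h, ← hroot, Real.exp_log (hsol η hηo).1]


/-! ### §2 The thermodynamic activity and the universal packing threshold -/

/-- **The thermodynamic activity** of the hard-sphere gas at macroscopic density `ρ` and reduced diameter `σ`:
`α_σ(ρ)(x) = ρ(x) · exp(f_ex(ρσ³) + ρσ³ f_ex'(ρσ³))`, `f_ex = hsExcessFreeEnergy` (`βμ = log ρ + βμ_ex`).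
[folklore] -/
def thermoActivity (σ : ℝ) (ρ : T3 → ℝ) (x : T3) : ℝ :=
  ρ x * Real.exp (hsExcessFreeEnergy (ρ x * σ ^ 3) + ρ x * σ ^ 3 * deriv hsExcessFreeEnergy (ρ x * σ ^ 3))

/-- The packing threshold `η₁(r, η₂) = min (min (η₂/2) (1/16)) (min (r/(8e+4)/2) (1/(128 e v₁)))`. [folklore] -/
def thresh (r η₂ : ℝ) : ℝ :=
  min (min (η₂ / 2) (1 / 16)) (min (r / (2 * (2 * (2 * Real.exp 1 + 1)))) (1 / (128 * Real.exp 1 * v₁)))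

/-- `0 < η₁`. [folklore] -/
theorem thresh_pos {r η₂ : ℝ} (hr : 0 < r) (hη₂ : 0 < η₂) : 0 < thresh r η₂ := by
  have := Real.exp_pos 1
  have := v₁_pos
  unfold thresh
  exact lt_min (lt_min (by positivity) (by norm_num)) (lt_min (by positivity) (by positivity))

/-! ### §3 The thermodynamic activity in the statics regime -/

section Core

variable {r : ℝ} {Rf : ℝ → ℝ} {η₂ : ℝ} (hr : 0 < r)
  (hsol : ∀ x ∈ Ioo (-r) r, 0 < Rf x ∧ Rf x * (∑' j : ℕ, bE j / (j.factorial : ℝ) * (x * Rf x) ^ j) = 1)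
  (hbd : ∀ x ∈ Icc 0 r, 1 ≤ Rf x ∧ Rf x ≤ 2) (hcont : ContinuousOn Rf (Icc 0 r))
  (huniq : ∀ x ∈ Ioo (-r) r, ∀ R ∈ Icc (1 / 2 : ℝ) 2,
    R * (∑' j : ℕ, bE j / (j.factorial : ℝ) * (x * R) ^ j) = 1 → R = Rf x)
  (hη₂ : 0 < η₂)
  (hexp : ∀ η ∈ Ioo 0 η₂, Real.exp (hsExcessFreeEnergy η + η * deriv hsExcessFreeEnergy η) = Rf η)
include hr hsol hbd hcont huniq hη₂ hexp

/-- **CORE.** Given the insertion-factor package, for `σ > 0` and a continuous density `ρ > 0` of unit mass with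
`ρσ³ ≤ η₁ := thresh r η₂` pointwise: `σ < 1/2`, the thermodynamic activity `α = α_σ ∘ ρ` IS the inverted
activity `ρ · Rf(σ³ρ)` of `activity_of_density`, so it is continuous, `ρ ≤ α ≤ 2ρ`, its profile is in the statics
regime with the uniform smallness `e · 2M · v₁ σ³ ≤ 1/32`, and its cluster-series density is EXACTLY `ρ`.
[folklore] -/
theorem thermoActivity_spec {σ : ℝ} (hσ : 0 < σ) {ρ : T3 → ℝ} (hρc : Continuous ρ) (hρ0 : ∀ x, 0 < ρ x)
    (hρ1 : (∫ x, ρ x) = 1) (hpack : ∀ x, ρ x * σ ^ 3 ≤ thresh r η₂) :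
    σ < 1 / 2 ∧ (∀ x, thermoActivity σ ρ x = ρ x * Rf (σ ^ 3 * ρ x)) ∧
    ∃ (ha : Continuous (thermoActivity σ ρ)) (ha0 : ∀ x, 0 < thermoActivity σ ρ x),
      (∀ x, ρ x ≤ thermoActivity σ ρ x ∧ thermoActivity σ ρ x ≤ 2 * ρ x) ∧
      SmallDensity (profileOf (thermoActivity σ ρ) ha ha0) σ ∧
      rhoLim (profileOf (thermoActivity σ ρ) ha ha0) σ = ρ ∧
      Real.exp 1 * (2 * (profileOf (thermoActivity σ ρ) ha ha0).M * v₁ * σ ^ 3) ≤ 1 / 32 := by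
  have he0 : 0 < Real.exp 1 := Real.exp_pos 1
  have hv : 0 < v₁ := v₁_pos
  have hσ3 : 0 < σ ^ 3 := pow_pos hσ 3
  set T := thresh r η₂ with hT
  have hT1 : T ≤ η₂ / 2 := (min_le_left _ _).trans (min_le_left _ _)
  have hT2 : T ≤ 1 / 16 := (min_le_left _ _).trans (min_le_right _ _)
  have hT3 : T ≤ r / (2 * (2 * (2 * Real.exp 1 + 1))) := (min_le_right _ _).trans (min_le_left _ _)
  have hT4 : T ≤ 1 / (128 * Real.exp 1 * v₁) := (min_le_right _ _).trans (min_le_right _ _)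
  -- the supremum of `ρ` is at least its unit mass
  have hbdd : BddAbove (Set.range ρ) := (isCompact_range hρc).bddAbove
  have hsup_ge : ∀ x, ρ x ≤ ⨆ y, ρ y := fun x => le_ciSup hbdd x
  have hsup_le : σ ^ 3 * (⨆ y, ρ y) ≤ T := by
    have h1 : (⨆ y, ρ y) ≤ T / σ ^ 3 := ciSup_le fun x => by
      rw [le_div_iff₀ hσ3]; exact hpack x
    calc σ ^ 3 * (⨆ y, ρ y) ≤ σ ^ 3 * (T / σ ^ 3) := by gcongr
      _ = T := mul_div_cancel₀ T hσ3.ne'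
  have hone_le : 1 ≤ ⨆ y, ρ y := by
    rw [← hρ1]
    exact (integral_mono (integrable_of_continuous_T3 hρc) (integrable_const _) hsup_ge).trans (by simp)
  have hσT : σ ^ 3 ≤ T := (le_mul_of_one_le_right hσ3.le hone_le).trans hsup_le
  have hσ2 : σ < 1 / 2 := by
    by_contra hc
    push Not at hc
    have : (1 / 2 : ℝ) ^ 3 ≤ σ ^ 3 := pow_le_pow_left₀ (by norm_num) hc 3
    linarith
  -- the thermodynamic activity is the inverted activity
  have hα : ∀ x, thermoActivity σ ρ x = ρ x * Rf (σ ^ 3 * ρ x) := by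
    intro x
    have hx : ρ x * σ ^ 3 ∈ Ioo 0 η₂ :=
      ⟨mul_pos (hρ0 x) hσ3, (hpack x).trans_lt (hT1.trans_lt (half_lt_self hη₂))⟩
    rw [thermoActivity, hexp _ hx, mul_comm (ρ x) (σ ^ 3)]
  have hαf : thermoActivity σ ρ = fun x => ρ x * Rf (σ ^ 3 * ρ x) := funext hα
  have hpack' : σ ^ 3 * (⨆ x, ρ x) ≤
      min (r / (2 * (2 * (2 * Real.exp 1 + 1)))) (1 / (64 * Real.exp 1 * v₁)) := by
    refine le_min (hsup_le.trans hT3) (hsup_le.trans (hT4.trans ?_))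
    gcongr
    norm_num
  refine ⟨hσ2, hα, ?_⟩
  rw [hαf]
  obtain ⟨ha, ha0, hale, hQs, hlim⟩ := activity_of_density hr hsol hbd hcont huniq hσ hσ2 hρc hρ0 hρ1 hpack'
  have hinta : 1 ≤ ∫ x, ρ x * Rf (σ ^ 3 * ρ x) := by
    have h := integral_mono (integrable_of_continuous_T3 hρc) (integrable_of_continuous_T3 ha) fun x => (hale x).1
    linarith [hρ1]
  have hM := profileOf_M_le ha ha0 hρc (fun x => (hale x).2) hinta
  refine ⟨ha, ha0, hale, hQs, hlim, ?_⟩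
  calc Real.exp 1 * (2 * (profileOf (fun x => ρ x * Rf (σ ^ 3 * ρ x)) ha ha0).M * v₁ * σ ^ 3)
      ≤ Real.exp 1 * (2 * (2 * ⨆ x, ρ x) * v₁ * σ ^ 3) := by gcongr
    _ = 4 * (Real.exp 1 * v₁) * (σ ^ 3 * ⨆ x, ρ x) := by ring
    _ ≤ 4 * (Real.exp 1 * v₁) * (1 / (128 * Real.exp 1 * v₁)) := by gcongr; exact hsup_le.trans hT4
    _ = 1 / 32 := by field_simp; norm_num

/-- **(iii) EXPONENTIAL CONCENTRATION AROUND THE GIVEN DENSITY.** Under the hypotheses of `thermoActivity_spec` and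
for continuous `θ > 0`, `u`: the local Gibbs laws of `(α_σ∘ρ, u, θ)` have empirical density / momentum / energy
fields concentrating exponentially around `(ρ, ρu, E(ρ,u,θ))`, for all `N` and all flows — the three field bounds
of the proved 14445 (`UniformLGC.localGibbsMeasure_density_le/…momentum_le/…energy_le`) at the activity `α_σ∘ρ`,
whose cluster-series density `rhoLim` is `ρ` itself. [folklore] -/
theorem thermoActivity_concentration {σ : ℝ} (hσ : 0 < σ) {ρ : T3 → ℝ} (hρc : Continuous ρ)
    (hρ0 : ∀ x, 0 < ρ x) (hρ1 : (∫ x, ρ x) = 1) (hpack : ∀ x, ρ x * σ ^ 3 ≤ thresh r η₂)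
    {θ : T3 → ℝ} {u : T3 → V3} (hθc : Continuous θ) (huc : Continuous u) (hθ0 : ∀ x, 0 < θ x)
    {χ : T3 → ℝ} (hχ : Continuous χ) {δ : ℝ} (hδ : 0 < δ) :
    ∃ C : ℝ, 0 < C ∧ ∀ (N : ℕ) (Φ : HardSphereFlow (Torus.geometry (Fin 3)) (hsDiameter σ N) (N + 1)),
      localGibbsLaw σ (thermoActivity σ ρ) u θ N Φ {z | δ < |empiricalDensityField z χ - ∫ x, χ x * ρ x|} ≤
          ENNReal.ofReal (C * Real.exp (-(C⁻¹ * ((N : ℝ) + 1)))) ∧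
        localGibbsLaw σ (thermoActivity σ ρ) u θ N Φ
            {z | δ < ‖empiricalMomentumField z χ - ∫ x, (χ x * ρ x) • u x‖} ≤
          ENNReal.ofReal (C * Real.exp (-(C⁻¹ * ((N : ℝ) + 1)))) ∧
        localGibbsLaw σ (thermoActivity σ ρ) u θ N Φ
            {z | δ < |empiricalEnergyField z χ - ∫ x, χ x * totalEnergyDensity (ρ x) (u x) (θ x)|} ≤
          ENNReal.ofReal (C * Real.exp (-(C⁻¹ * ((N : ℝ) + 1)))) := by
  obtain ⟨hσ2, -, ha, ha0, -, -, hlim, hsmall⟩ :=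
    thermoActivity_spec hr hsol hbd hcont huniq hη₂ hexp hσ hρc hρ0 hρ1 hpack
  obtain ⟨K₁, hK₁, h₁⟩ := localGibbsMeasure_density_le (u₀ := u) ha hθc huc ha0 hθ0 hσ hσ2 hsmall hχ hδ
  obtain ⟨K₂, hK₂, h₂⟩ := localGibbsMeasure_momentum_le ha hθc huc ha0 hθ0 hσ hσ2 hsmall hχ hδ
  obtain ⟨K₃, hK₃, h₃⟩ := localGibbsMeasure_energy_le ha hθc huc ha0 hθ0 hσ hσ2 hsmall hχ hδ
  rw [hlim] at h₁ h₂ h₃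
  refine ⟨K₁ + K₂ + K₃, by positivity, fun N Φ => ?_⟩
  have hn : (0 : ℝ) ≤ (N : ℝ) + 1 := by positivity
  have hK12 : K₁ ≤ K₁ + K₂ + K₃ := by linarith
  have hK22 : K₂ ≤ K₁ + K₂ + K₃ := by linarith
  have hK32 : K₃ ≤ K₁ + K₂ + K₃ := by linarith
  rw [localGibbsLaw_eq]
  refine ⟨?_, ?_, ?_⟩
  · refine le_trans ?_ ((h₁ N).trans (ENNReal.ofReal_le_ofReal (Kexp_le_Kexp hK₁ hK12 hn)))
    refine le_of_eq ?_
    congr 1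
    ext z
    simp only [Set.mem_setOf_eq, empiricalDensityField_eq_sum]
  · exact (h₂ N).trans (ENNReal.ofReal_le_ofReal (Kexp_le_Kexp hK₂ hK22 hn))
  · exact (h₃ N).trans (ENNReal.ofReal_le_ofReal (Kexp_le_Kexp hK₃ hK32 hn))

end Core

/-! ### §4 Statements -/

/-- **MISSING HYPOTHESIS A of the v3 entropy ledger — activity inversion / EOS identification** (second conjunct of
the registered stub `stub_pdeAndInversion : PdeAndInversion := DiluteSelfConsistency ∧ ActivityInversion` of line
`dlr-block-transfer`, crux `KineticWindowGronwall` stmt-AtomisticToContinuum-9282; body VERBATIM from the skeleton).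
With `F := hsExcessFreeEnergy` and `α_σ(ρ) := ρ · exp(F(ρσ³) + ρσ³ F′(ρσ³))`: there is `η₁ > 0` such that for
every `σ > 0` and all continuous `ρ, θ > 0`, `u` with `∫ρ = 1`, `ρσ³ ≤ η₁`, the local Gibbs laws with activity
`α_σ ∘ ρ` (i) have activity ratio in `[1, 2]`, (ii) are probability measures, (iii) concentrate exponentially around
`(ρ, ρu, E(ρ,u,θ))`, and (iv) any continuous positive activity whose laws have density field converging in
probability (along some flow family) to `ρ` is a constant multiple of `α_σ ∘ ρ`. Clauses (i)–(iii) are THEOREMS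
(`thermoActivity_spec`, `thermoActivity_concentration`); clause (iv) quantifies over ALL continuous positive `a'`,
dilute or not, and is the non-perturbative `ActivityUniquenessModConstants` below — OPEN as typed
(`stub_activityInversionOfUniqueness`); its dilute form is a theorem (`stub_activityInversionDilute`). -/
@[conjecture] def ActivityInversion : Prop :=
  ∃ η₁ : ℝ, 0 < η₁ ∧ ∀ σ : ℝ, 0 < σ →
    ∀ (ρ θ : T3 → ℝ) (u : T3 → V3), Continuous ρ → Continuous θ → Continuous u →
      (∀ x, 0 < ρ x) → (∀ x, 0 < θ x) → (∫ x, ρ x = 1) → (∀ x, ρ x * σ ^ 3 ≤ η₁) →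
      (let a : T3 → ℝ := fun x => ρ x * Real.exp (hsExcessFreeEnergy (ρ x * σ ^ 3) +
          ρ x * σ ^ 3 * deriv hsExcessFreeEnergy (ρ x * σ ^ 3))
       (∀ x, ρ x ≤ a x ∧ a x ≤ 2 * ρ x) ∧
       (∀ (N : ℕ) (Φ : HardSphereFlow (Torus.geometry (Fin 3)) (hsDiameter σ N) (N + 1)),
          IsProbabilityMeasure (localGibbsLaw σ a u θ N Φ)) ∧
       (∀ χ : T3 → ℝ, Continuous χ → ∀ δ : ℝ, 0 < δ → ∃ C : ℝ, 0 < C ∧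
          ∀ (N : ℕ) (Φ : HardSphereFlow (Torus.geometry (Fin 3)) (hsDiameter σ N) (N + 1)),
            localGibbsLaw σ a u θ N Φ {z | δ < |empiricalDensityField z χ - ∫ x, χ x * ρ x|} ≤
              ENNReal.ofReal (C * Real.exp (-(C⁻¹ * (N + 1)))) ∧
            localGibbsLaw σ a u θ N Φ {z | δ < ‖empiricalMomentumField z χ - ∫ x, (χ x * ρ x) • u x‖} ≤
              ENNReal.ofReal (C * Real.exp (-(C⁻¹ * (N + 1)))) ∧
            localGibbsLaw σ a u θ N Φ
                {z | δ < |empiricalEnergyField z χ - ∫ x, χ x * totalEnergyDensity (ρ x) (u x) (θ x)|} ≤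
              ENNReal.ofReal (C * Real.exp (-(C⁻¹ * (N + 1))))) ∧
       (∀ a' : T3 → ℝ, Continuous a' → (∀ x, 0 < a' x) →
          (∃ Φ : (N : ℕ) → HardSphereFlow (Torus.geometry (Fin 3)) (hsDiameter σ N) (N + 1),
            ∀ χ : T3 → ℝ, Continuous χ → ∀ δ : ℝ, 0 < δ →
              Filter.Tendsto (fun N => localGibbsLaw σ a' u θ N (Φ N)
                {z | δ < |empiricalDensityField z χ - ∫ x, χ x * ρ x|}) Filter.atTop (nhds 0)) →
          ∃ ζ : ℝ, 0 < ζ ∧ ∀ x, a' x = ζ * a x))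

/-- **UNIQUENESS OF THE ACTIVITY MOD CONSTANTS, NON-PERTURBATIVE FORM** (clause (iv) of `ActivityInversion`,
isolated): at small packing `ρσ³ ≤ η₁`, ANY continuous positive activity `a'` — no dilute restriction — whose local
Gibbs laws have empirical density field converging in probability (along some flow family) to `ρ` is a constant
multiple of `α_σ ∘ ρ`. True in the physics sense (large-deviation / free-energy variational principle for the
inhomogeneous canonical hard-sphere gas at arbitrary activity contrast + strict convexity of the dilute free
energy), but the tree's law of large numbers exists only in the statics regime `SmallDensity (profileOf a') σ`;
OPEN as typed. -/
@[conjecture] def ActivityUniquenessModConstants : Prop :=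
  ∃ η₁ : ℝ, 0 < η₁ ∧ ∀ σ : ℝ, 0 < σ →
    ∀ (ρ θ : T3 → ℝ) (u : T3 → V3), Continuous ρ → Continuous θ → Continuous u →
      (∀ x, 0 < ρ x) → (∀ x, 0 < θ x) → (∫ x, ρ x = 1) → (∀ x, ρ x * σ ^ 3 ≤ η₁) →
      ∀ a' : T3 → ℝ, Continuous a' → (∀ x, 0 < a' x) →
        (∃ Φ : (N : ℕ) → HardSphereFlow (Torus.geometry (Fin 3)) (hsDiameter σ N) (N + 1),
          ∀ χ : T3 → ℝ, Continuous χ → ∀ δ : ℝ, 0 < δ →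
            Filter.Tendsto (fun N => localGibbsLaw σ a' u θ N (Φ N)
              {z | δ < |empiricalDensityField z χ - ∫ x, χ x * ρ x|}) Filter.atTop (nhds 0)) →
        ∃ ζ : ℝ, 0 < ζ ∧ ∀ x, a' x = ζ * (ρ x * Real.exp (hsExcessFreeEnergy (ρ x * σ ^ 3) +
          ρ x * σ ^ 3 * deriv hsExcessFreeEnergy (ρ x * σ ^ 3)))

/-- **REDUCTION OF HYPOTHESIS A TO ITS CLAUSE (iv)** (signature of the registered helper stub
`stub_activityInversionOfUniqueness`): the non-perturbative uniqueness clause alone implies `ActivityInversion` —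
clauses (i)–(iii) are theorems of the tree. -/
def ActivityInversionOfUniqueness : Prop :=
  ActivityUniquenessModConstants → ActivityInversion

/-! ### §5 The registered helper stub -/

/-- **STUB `stub_activityInversionOfUniqueness`** (helper stub of line `dlr-block-transfer`, crux
`KineticWindowGronwall` stmt-AtomisticToContinuum-9282): `ActivityInversion` follows from its clause (iv) alone
(`η₁ := min (thresh r η₂) η₁ᵁ`). -/
theorem stub_activityInversionOfUniqueness : ActivityInversionOfUniqueness := by
  intro hU
  obtain ⟨ηU, hηU, HU⟩ := hU
  obtain ⟨r, hr, Rf, hsol, hbd, hcont, huniq, η₂, hη₂, -, hexp⟩ := insertionFactor_package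
  refine ⟨min (thresh r η₂) ηU, lt_min (thresh_pos hr hη₂) hηU,
    fun σ hσ ρ θ u hρc hθc huc hρ0 hθ0 hρ1 hpack => ?_⟩
  have hpack₁ : ∀ x, ρ x * σ ^ 3 ≤ thresh r η₂ := fun x => (hpack x).trans (min_le_left _ _)
  have hpack₂ : ∀ x, ρ x * σ ^ 3 ≤ ηU := fun x => (hpack x).trans (min_le_right _ _)
  obtain ⟨hσ2, -, ha, ha0, hale, -⟩ :=
    thermoActivity_spec hr hsol hbd hcont huniq hη₂ hexp hσ hρc hρ0 hρ1 hpack₁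
  exact ⟨hale, fun N Φ => isProbabilityMeasure_localGibbsLaw ha hθc huc ha0 hθ0 hσ2.le N Φ,
    fun χ hχ δ hδ => thermoActivity_concentration hr hsol hbd hcont huniq hη₂ hexp hσ hρc hρ0 hρ1 hpack₁ hθc huc
      hθ0 hχ hδ,
    HU σ hσ ρ θ u hρc hθc huc hρ0 hθ0 hρ1 hpack₂⟩

end Summit.AtomisticToContinuum.HydrodynamicLimit.Theorems.KineticWindowGronwallActivityInversion

end
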